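import Literature.AlgebraicGeometry.Resolution.NormalCrossingsBlowupStepReduction
import Literature.AlgebraicGeometry.Resolution.BlowupChartRsopIdeals
import Literature.AlgebraicGeometry.Resolution.BlowupStalkCharts
import HarnessLib

/-!
# De Jong 1996, 2.4, the blowing-up step: discharge of `SNCBlowupTopStratum`

Topic: `Literature/AlgebraicGeometry/Resolution`. Proofs file for
`NormalCrossingsBlowupStepReduction.lean`: the named fact `SNCBlowupTopStratum` (the chart
computation behind de Jong 1996, 2.4, p. 55 — "blow up the points where `D` has three branches,
then the strict transform of the curves where `D` has two branches, etc."; the source prints no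
proof) is PROVED here, `SNCBlowupTopStratum_holds`, by assembling the nodes of the decomposition
already in the tree:

* the strata (`SncStrata.lean`): matched coordinates `(f ; g)` at a point of a strict normal
  crossings pair `F ⊆ Z` (`exists_matched_rsop`), `n = m + 1` unmarked branches on the top
  stratum `C` and `I(C)_s = (g₁, …, g_{m+1})` (`stalkIdeal_vanishingIdeal_topStratum`);
* the dictionary (`BlowupStalkCharts.lean`): the local ring of ANY blowing up `φ : S₁ → S` of
  `I_C` at `s₁` over `s ∈ C` is a localisation of a chart `𝒪_{S,s}[g/g_j]` at a prime over `𝔪_s`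
  (`IsBlowup.exists_reesChart_stalk`);
* the chart algebra (`BlowupChartRsop.lean`, `BlowupChartRsopIdeals.lean`): in such a
  localisation the reduced total transform of `Z` is cut out by the product of the part
  `ζ = (g_j, (g_i/g_j)_{i ∈ J}, f)` of a regular system of parameters, `#J ≤ m`
  (`radical_map_span_prod_marked_mul_prod_centre`), that of `F ∪ C` by `g_j · ∏ f`
  (`radical_map_span_prod_marked_inf_radical_map_span_centre`, `isRsopPart_cons_centre_marked`);
* `I(φ⁻¹A)_{s₁} = √(I(A)_{φ s₁} 𝒪_{S₁,s₁})` (`stalkIdeal_vanishingIdeal_preimage`,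
  `StalkIdealLemmas.lean`), and off the centre `φ` is a local isomorphism
  (`IsBlowup.isIso_morphismRestrict`, `Blowups.lean`), along which the strict normal crossings
  condition and branch orders are transported (`IsStrictNormalCrossingsAt.iff_of_isOpenImmersion`,
  `branchOrder_preimage_of_etale`).

Contents (all PROVED):

* `IsRsopPart.exists_equiv_associated`, `IsRsopPart.cons_of_associated` — bookkeeping for
  passing from the matched coordinates to the arbitrary `g`, `x` of the statement;
  `Ideal.radical_map_inf` — `√((𝔞 ∩ 𝔟)B) = √(𝔞B) ∩ √(𝔟B)`.
* `stalkIdeal_vanishingIdeal_closure_preimage`, `stalkIdeal_vanishingIdeal_union`,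
  `branchOrder_congr_stalkIdeal` — stalks of vanishing ideals of preimages and unions (off a
  closed set the stalk of its vanishing ideal is the unit ideal by
  `stalkIdeal_eq_top_of_not_mem_support`, `MarkedIdealsLemmas.lean`).
* `IsBlowup.isIso_stalkMap_of_not_mem`, `IsBlowup.isStrictNormalCrossingsAt_preimage_of_not_mem`,
  `IsBlowup.branchOrder_preimage_of_not_mem` — off the centre.
* `exists_chart_data_of_mem_topStratum` — on the centre: the chart computation read off in
  `𝒪_{S₁,s₁}`.
* `SNCBlowupTopStratum_holds` — DISCHARGE of `SNCBlowupTopStratum`;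
  `DeJong1996NormalCrossingsBlowupStep_holds` — DISCHARGE of
  `DeJong1996NormalCrossingsBlowupStep` (`NormalCrossingsStrictification.lean`) through
  `DeJong1996NormalCrossingsBlowupStep.of_sncBlowupTopStratum`.

## Sources

* A. J. de Jong, *Smoothness, semi-stability and alterations*, Publ. Math. IHÉS 83 (1996) 51–93,
  2.4 (p. 55). [DeJong1996]
* The Stacks Project, Tags 0804 (charts of a blowing up), 0BI9, 0BIA (strict normal crossings),
  02OS (a blowing up is an isomorphism off the centre). [StacksProject]
* U. Görtz, T. Wedhorn, *Algebraic Geometry I*, 2nd ed. (2020), Prop. 13.91. [GortzWedhorn2020]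
-/

noncomputable section

open CategoryTheory CategoryTheory.Limits AlgebraicGeometry TopologicalSpace IsLocalRing

namespace Literature.AlgebraicGeometry.Resolution

open Scheme.IdealSheafData

universe u

/-! ## Algebra: rearranging parts of regular systems of parameters -/

section Algebra

variable {R : Type u} [CommRing R] [IsLocalRing R]

/-- Two parts of regular systems of parameters cutting out the same divisor have the same length
and agree up to a permutation and units. [folklore] -/
theorem IsRsopPart.exists_equiv_associated {n k : ℕ} {x : Fin n → R} {f : Fin k → R}
    (hx : IsRsopPart x) (hf : IsRsopPart f)
    (h : Ideal.span {∏ t, x t} = Ideal.span {∏ s, f s}) :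
    ∃ σ : Fin n ≃ Fin k, ∀ t, Associated (x t) (f (σ t)) := by
  obtain ⟨σ, hσ, hσa⟩ := hx.exists_injective_associated hf h
  obtain ⟨τ, hτ, -⟩ := hf.exists_injective_associated hx h.symm
  have hnk : n = k := by
    have h1 := Fintype.card_le_of_injective σ hσ
    have h2 := Fintype.card_le_of_injective τ hτ
    simp only [Fintype.card_fin] at h1 h2
    omega
  subst hnk
  have hbij : Function.Bijective σ := (Finite.injective_iff_bijective).mp hσ
  exact ⟨Equiv.ofBijective σ hbij, fun t => hσa t⟩

/-- **Replacing the members of `(c₀, f')` by associates, the tail up to a permutation.** If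
`(c₀, f'₁, …, f'_k)` is part of a regular system of parameters of the local ring `R`, `g₀` is
associated to `c₀`, and `x'` is a family associated memberwise to a permutation of `f'`, then
`(g₀, x')` is part of a regular system of parameters and `(∏ (g₀, x')) = (c₀ · ∏ f')`.
[folklore] -/
theorem IsRsopPart.cons_of_associated {k n : ℕ} {c₀ : R} {f' : Fin k → R}
    (hζ : IsRsopPart (Fin.cons c₀ f' : Fin (k + 1) → R)) {g₀ : R} (hg : Associated g₀ c₀)
    {x' : Fin n → R} (σ : Fin n ≃ Fin k) (hx : ∀ t, Associated (x' t) (f' (σ t))) :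
    IsRsopPart (Fin.cons g₀ x' : Fin (n + 1) → R) ∧
      Ideal.span {∏ i, (Fin.cons g₀ x' : Fin (n + 1) → R) i} = Ideal.span {c₀ * ∏ s, f' s} := by
  have hnk : n = k := by simpa using Fintype.card_eq.mpr ⟨σ⟩
  subst hnk
  -- the permutation of `Fin (n + 1)` fixing `0` and acting by `σ` on the successors
  set τ : Equiv.Perm (Fin (n + 1)) :=
    (finSuccEquiv n).trans ((Equiv.optionCongr σ).trans (finSuccEquiv n).symm) with hτ
  have hτ0 : τ 0 = 0 := by simp [hτ]
  have hτs : ∀ t, τ t.succ = (σ t).succ := fun t => by simp [hτ]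
  have h1 : IsRsopPart ((Fin.cons c₀ f' : Fin (n + 1) → R) ∘ τ) := hζ.comp_equiv τ
  have h2 : ∀ i, Associated (((Fin.cons c₀ f' : Fin (n + 1) → R) ∘ τ) i)
      ((Fin.cons g₀ x' : Fin (n + 1) → R) i) := by
    intro i
    refine Fin.cases ?_ (fun t => ?_) i
    · simpa [hτ0] using hg.symm
    · simpa [hτs] using (hx t).symm
  refine ⟨h1.of_associated h2, ?_⟩
  haveI := hζ.isRegularLocalRing
  haveI := isDomain_of_isRegularLocalRing R
  rw [Ideal.span_singleton_eq_span_singleton]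
  rw [Fin.prod_univ_succ]
  simp only [Fin.cons_zero, Fin.cons_succ]
  refine hg.mul_mul ?_
  have h4 : ∏ t, f' (σ t) = ∏ s, f' s := Equiv.prod_comp σ f'
  rw [← h4]
  exact Associated.prod _ _ _ fun t _ => hx t

/-- The range of `Fin.append u v` is the union of the ranges (cf. `range_fin_append` of
`AlterationsEnlargingZ.lean`, not imported here). [folklore] -/
private theorem range_finAppend {α : Type*} {m n : ℕ} (u : Fin m → α) (v : Fin n → α) :
    Set.range (Fin.append u v) = Set.range u ∪ Set.range v := by
  ext a
  constructor
  · rintro ⟨i, rfl⟩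
    refine Fin.addCases (fun j => ?_) (fun j => ?_) i
    · exact Or.inl ⟨j, (Fin.append_left u v j).symm⟩
    · exact Or.inr ⟨j, (Fin.append_right u v j).symm⟩
  · rintro (⟨j, rfl⟩ | ⟨j, rfl⟩)
    · exact ⟨Fin.castAdd n j, Fin.append_left u v j⟩
    · exact ⟨Fin.natAdd m j, Fin.append_right u v j⟩

/-- **Radicals of extended intersections**: `√((𝔞 ∩ 𝔟) B) = √(𝔞 B) ∩ √(𝔟 B)` for a ring
homomorphism `A → B` (`𝔞 𝔟 ⊆ 𝔞 ∩ 𝔟` and `√(𝔞 B · 𝔟 B) = √(𝔞 B) ∩ √(𝔟 B)`). [folklore] -/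
theorem Ideal.radical_map_inf {A B : Type*} [CommRing A] [CommRing B] (h : A →+* B)
    (𝔞 𝔟 : Ideal A) :
    ((𝔞 ⊓ 𝔟).map h).radical = (𝔞.map h).radical ⊓ (𝔟.map h).radical := by
  apply le_antisymm
  · rw [← Ideal.radical_inf]
    exact Ideal.radical_mono (le_inf (Ideal.map_mono inf_le_left) (Ideal.map_mono inf_le_right))
  · rw [← Ideal.radical_mul, ← Ideal.map_mul]
    exact Ideal.radical_mono (Ideal.map_mono Ideal.mul_le_inf)

end Algebra

/-! ## Stalks of vanishing ideals: preimages and unions -/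

section Stalks

variable {X Y : Scheme.{u}}

/-- `I(closure (f⁻¹ Z))_x = √(I(closure Z)_{f x} · 𝒪_{X,x})` for `Z` closed (the closures are
no-ops; `stalkIdeal_vanishingIdeal_preimage`). [folklore] -/
theorem stalkIdeal_vanishingIdeal_closure_preimage (f : X ⟶ Y) {Z : Set Y} (hZ : IsClosed Z)
    (x : X) :
    stalkIdeal (vanishingIdeal ⟨closure (f ⁻¹' Z), isClosed_closure⟩) x =
      ((stalkIdeal (vanishingIdeal ⟨closure Z, isClosed_closure⟩) (f x)).map
        (f.stalkMap x).hom).radical := by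
  have hcl : (⟨closure Z, isClosed_closure⟩ : Closeds Y) = ⟨Z, hZ⟩ := Closeds.ext hZ.closure_eq
  have hcl' : (⟨closure (f ⁻¹' Z), isClosed_closure⟩ : Closeds X) =
      (⟨Z, hZ⟩ : Closeds Y).preimage f.continuous := by
    apply Closeds.ext
    simp only [Closeds.coe_mk, Closeds.coe_preimage]
    exact (hZ.preimage f.continuous).closure_eq
  rw [hcl, hcl', stalkIdeal_vanishingIdeal_preimage]

/-- `I(A ∪ B)_x = I(A)_x ∩ I(B)_x` for closed `A, B`. [folklore] -/
theorem stalkIdeal_vanishingIdeal_union {A B : Set X} (hA : IsClosed A) (hB : IsClosed B) (x : X) :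
    stalkIdeal (vanishingIdeal ⟨A ∪ B, hA.union hB⟩) x =
      stalkIdeal (vanishingIdeal ⟨A, hA⟩) x ⊓ stalkIdeal (vanishingIdeal ⟨B, hB⟩) x := by
  have h : (⟨A ∪ B, hA.union hB⟩ : Closeds X) = (⟨A, hA⟩ : Closeds X) ⊔ ⟨B, hB⟩ :=
    Closeds.ext (by simp)
  rw [h, vanishingIdeal_sup, stalkIdeal_inf]

/-- The branch order only depends on the stalk of the vanishing ideal. [folklore] -/
theorem branchOrder_congr_stalkIdeal {Z Z' : Set X} {x : X}
    (h : stalkIdeal (vanishingIdeal ⟨closure Z, isClosed_closure⟩) x =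
      stalkIdeal (vanishingIdeal ⟨closure Z', isClosed_closure⟩) x) :
    branchOrder X Z x = branchOrder X Z' x := by
  apply le_antisymm
  · refine ENat.forall_natCast_le_iff_le.mp fun n hn => ?_
    rw [branchOrder_def, le_idealOrder_iff] at hn ⊢
    rwa [← h]
  · refine ENat.forall_natCast_le_iff_le.mp fun n hn => ?_
    rw [branchOrder_def, le_idealOrder_iff] at hn ⊢
    rwa [h]

end Stalks

/-! ## Off the centre: transport along the open immersion `φ⁻¹(S ∖ C) → S` -/

section OffCentre

variable {S S₁ : Scheme.{u}} {φ : S₁ ⟶ S} {I : S.IdealSheafData} (hφ : IsBlowup φ I)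
  {C : Set S} (hC : IsClosed C) (hIC : (I.support : Set S) = C)

include hφ hIC in
/-- Over the complement of the centre a blowing up restricts to an isomorphism
(`IsBlowup.isIso_morphismRestrict`). [cite: GortzWedhorn2020, Prop. 13.91 (3)] -/
theorem IsBlowup.isIso_morphismRestrict_compl :
    IsIso (φ ∣_ (⟨Cᶜ, hC.isOpen_compl⟩ : S.Opens)) := by
  refine hφ.isIso_morphismRestrict ?_
  rw [hIC]
  exact disjoint_compl_left

include hφ hC hIC in
/-- Off the centre the stalk maps of a blowing up are isomorphisms. [folklore] -/
theorem IsBlowup.isIso_stalkMap_of_not_mem {s₁ : S₁} (hs : φ s₁ ∉ C) :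
    IsIso (φ.stalkMap s₁) := by
  haveI := hφ.isIso_morphismRestrict_compl hC hIC
  exact isIso_stalkMap_of_isIso_morphismRestrict φ ⟨Cᶜ, hC.isOpen_compl⟩ s₁ hs

include hφ hC hIC in
/-- Off the centre, `φ` restricted to `φ⁻¹(S ∖ C)` followed by the inclusion is an open immersion
`φ⁻¹(S ∖ C) → S`. [folklore] -/
theorem IsBlowup.isOpenImmersion_ι_comp :
    IsOpenImmersion ((φ ⁻¹ᵁ (⟨Cᶜ, hC.isOpen_compl⟩ : S.Opens)).ι ≫ φ) := by
  haveI := hφ.isIso_morphismRestrict_compl hC hIC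
  rw [← morphismRestrict_ι]
  infer_instance

include hφ hC hIC in
/-- **Off the centre the strict normal crossings condition lifts along a blowing up**: for
`A ⊆ S` closed with strict normal crossings at `φ s₁ ∉ C`, `φ⁻¹ A` has strict normal crossings
at `s₁` (transport along the open immersion `φ⁻¹(S ∖ C) → S`). [folklore] -/
theorem IsBlowup.isStrictNormalCrossingsAt_preimage_of_not_mem {A : Set S} (hA : IsClosed A)
    {s₁ : S₁} (hs : φ s₁ ∉ C) (h : IsStrictNormalCrossingsAt S A (φ s₁)) :
    IsStrictNormalCrossingsAt S₁ (φ ⁻¹' A) s₁ := by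
  set U : S.Opens := ⟨Cᶜ, hC.isOpen_compl⟩ with hU
  haveI := hφ.isOpenImmersion_ι_comp hC hIC
  let t : ↥(φ ⁻¹ᵁ U) := ⟨s₁, hs⟩
  have ht : (φ ⁻¹ᵁ U).ι t = s₁ := rfl
  have hpre : (φ ⁻¹ᵁ U).ι ⁻¹' (φ ⁻¹' A) = ((φ ⁻¹ᵁ U).ι ≫ φ) ⁻¹' A := by
    ext v
    simp only [Set.mem_preimage, Scheme.Hom.comp_apply]
  rw [← ht, IsStrictNormalCrossingsAt.iff_of_isOpenImmersion _ (hA.preimage φ.continuous), hpre,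
    ← IsStrictNormalCrossingsAt.iff_of_isOpenImmersion _ hA]
  exact h

include hφ hC hIC in
/-- **Off the centre branch orders are unchanged by a blowing up** (`S` locally Noetherian):
`branchOrder S₁ (φ⁻¹ A) s₁ = branchOrder S A (φ s₁)` for `A` closed and `φ s₁ ∉ C`. [folklore] -/
theorem IsBlowup.branchOrder_preimage_of_not_mem [IsLocallyNoetherian S] {A : Set S}
    (hA : IsClosed A) {s₁ : S₁} (hs : φ s₁ ∉ C) :
    branchOrder S₁ (φ ⁻¹' A) s₁ = branchOrder S A (φ s₁) := by
  set U : S.Opens := ⟨Cᶜ, hC.isOpen_compl⟩ with hU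
  haveI := hφ.isOpenImmersion_ι_comp hC hIC
  haveI : IsLocallyNoetherian S₁ := isLocallyNoetherian_of_isBlowup hφ
  let t : ↥(φ ⁻¹ᵁ U) := ⟨s₁, hs⟩
  have ht : (φ ⁻¹ᵁ U).ι t = s₁ := rfl
  have hpre : (φ ⁻¹ᵁ U).ι ⁻¹' (φ ⁻¹' A) = ((φ ⁻¹ᵁ U).ι ≫ φ) ⁻¹' A := by
    ext v
    simp only [Set.mem_preimage, Scheme.Hom.comp_apply]
  rw [← ht, ← branchOrder_preimage_of_etale (φ ⁻¹ᵁ U).ι (hA.preimage φ.continuous), hpre,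
    branchOrder_preimage_of_etale _ hA, Scheme.Hom.comp_apply]

end OffCentre

/-! ## On the centre: the chart computation read off in `𝒪_{S₁,s₁}` -/

section OnCentre

variable {S S₁ : Scheme.{u}} [IsLocallyNoetherian S] {Z F : Set S} {m : ℕ}
  (hZ : IsStrictNormalCrossingsDivisor S Z) (hF : IsStrictNormalCrossingsDivisor S F)
  (hFZ : F ⊆ Z) (hb : ∀ s ∈ Z, branchOrder S Z s ≤ branchOrder S F s + (m + 1 : ℕ))
  (hC : IsClosed (topStratum S Z F m)) {φ : S₁ ⟶ S}
  (hφ : IsBlowup φ (vanishingIdeal ⟨topStratum S Z F m, hC⟩))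

include hZ hF hFZ hb hφ in
/-- **Local structure of the blowing up of the top stratum at a point over the centre.** Let
`s₁ ∈ S₁` with `s = φ s₁ ∈ C = topStratum S Z F m`. There are matched coordinates
`(f₁, …, f_k ; g₁, …, g_{m+1})` at `s` (`I(F)_s = (∏ fⱼ)`, `I(C)_s = (g)`), an index `j` with
`I(C) · 𝒪_{S₁,s₁} = (φ^* g_j)` (the exceptional divisor), and a part `ζ` of a regular system of
parameters of `𝒪_{S₁,s₁}` of length `a + k + 1`, `a ≤ m`, with `I(φ⁻¹Z)_{s₁} = (∏ ζ)`;
moreover `(φ^* g_j, φ^* f₁, …, φ^* f_k)` is part of a regular system of parameters of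
`𝒪_{S₁,s₁}` and `I(φ⁻¹(F ∪ C))_{s₁} = (φ^* g_j · ∏ φ^* fⱼ)`. (The local ring `𝒪_{S₁,s₁}` is a
localisation of the chart `𝒪_{S,s}[g/g_j]`, `IsBlowup.exists_reesChart_stalk`, where these are
`radical_map_span_prod_marked_mul_prod_centre`,
`radical_map_span_prod_marked_inf_radical_map_span_centre` and `isRsopPart_cons_centre_marked`.)
[cite: DeJong1996, 2.4, p. 55] -/
theorem exists_chart_data_of_mem_topStratum (s₁ : S₁) (hs : φ s₁ ∈ topStratum S Z F m) :
    ∃ (k a : ℕ) (f : Fin k → S.presheaf.stalk (φ s₁))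
      (g : Fin (m + 1) → S.presheaf.stalk (φ s₁)) (j : Fin (m + 1))
      (ζ : Fin (a + k + 1) → S₁.presheaf.stalk s₁),
      IsRsopPart f ∧
      stalkIdeal (vanishingIdeal ⟨closure F, isClosed_closure⟩) (φ s₁) = Ideal.span {∏ s, f s} ∧
      stalkIdeal ((vanishingIdeal ⟨topStratum S Z F m, hC⟩).comap φ) s₁ =
        Ideal.span {(φ.stalkMap s₁).hom (g j)} ∧
      a ≤ m ∧ IsRsopPart ζ ∧
      stalkIdeal (vanishingIdeal ⟨closure (φ ⁻¹' Z), isClosed_closure⟩) s₁ =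
        Ideal.span {∏ t, ζ t} ∧
      IsRsopPart (Fin.cons ((φ.stalkMap s₁).hom (g j)) ((φ.stalkMap s₁).hom ∘ f) :
        Fin (k + 1) → _) ∧
      stalkIdeal (vanishingIdeal
          ⟨closure (φ ⁻¹' (F ∪ topStratum S Z F m)), isClosed_closure⟩) s₁ =
        Ideal.span {(φ.stalkMap s₁).hom (g j) * ∏ s, (φ.stalkMap s₁).hom (f s)} := by
  classical
  have hCZ : topStratum S Z F m ⊆ Z := topStratum_subset m
  have hsZ : φ s₁ ∈ Z := hCZ hs
  have hZc : IsClosed Z := hZ.isClosed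
  have hFc : IsClosed F := hF.isClosed
  -- matched coordinates at `s = φ s₁`
  obtain ⟨k, n, f, g, -, hfg, hIZ, hIF⟩ := exists_matched_rsop hFZ hFc
    (hZ.isStrictNormalCrossingsAt hsZ) fun h => hF.isStrictNormalCrossingsAt h
  have hclZ : (⟨closure Z, isClosed_closure⟩ : Closeds S) = ⟨Z, hZc⟩ := Closeds.ext hZc.closure_eq
  have hclF : (⟨closure F, isClosed_closure⟩ : Closeds S) = ⟨F, hFc⟩ := Closeds.ext hFc.closure_eq
  have hclFC : (⟨closure (F ∪ topStratum S Z F m), isClosed_closure⟩ : Closeds S) =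
      ⟨F ∪ topStratum S Z F m, hFc.union hC⟩ := Closeds.ext (hFc.union hC).closure_eq
  have hIZ' : stalkIdeal (vanishingIdeal ⟨Z, hZc⟩) (φ s₁) =
      Ideal.span {(∏ j, f j) * ∏ i, g i} := by
    rw [← hclZ]; exact hIZ
  obtain rfl : n = m + 1 := eq_of_mem_topStratum_of_matched hZ hfg hIZ' hIF hs
  have hIC : stalkIdeal (vanishingIdeal ⟨topStratum S Z F m, hC⟩) (φ s₁) =
      Ideal.span (Set.range g) :=
    stalkIdeal_vanishingIdeal_topStratum hZ hF hFZ hb hfg hIZ' hIF hs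
  haveI : IsRegularLocalRing (S.presheaf.stalk (φ s₁)) := hfg.isRegularLocalRing
  -- complete `(g, f)` to a regular system of parameters `(g, f, y)`
  obtain ⟨e, xf, hd', hspan, hxf⟩ := hfg.exists_rsop
  set y : Fin e → S.presheaf.stalk (φ s₁) := fun t => xf (Fin.natAdd (k + (m + 1)) t) with hy
  have hxf' : xf = Fin.append (Fin.append f g) y := by
    funext i
    refine Fin.addCases (fun i => ?_) (fun t => ?_) i
    · rw [Fin.append_left, hxf]
    · rw [Fin.append_right]
  have hz : Ideal.span (Set.range (Fin.append g (Fin.append f y))) =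
      maximalIdeal (S.presheaf.stalk (φ s₁)) := by
    rw [← hspan, hxf', range_finAppend, range_finAppend, range_finAppend, range_finAppend]
    congr 1
    ext v
    simp only [Set.mem_union]
    tauto
  have hd : (maximalIdeal (S.presheaf.stalk (φ s₁))).spanFinrank = (m + 1) + (k + e) := by
    rw [hd']; ring
  -- the chart through `s₁`
  obtain ⟨j, 𝔴, χ, hχ, hloc, h𝔴⟩ := hφ.exists_reesChart_stalk s₁ g hIC.symm
  letI := χ.toAlgebra
  haveI := hloc
  have halg : ∀ v, algebraMap (chartRing g j) (S₁.presheaf.stalk s₁) (chartBase g j v) =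
      (φ.stalkMap s₁).hom v := fun v => by
    rw [RingHom.algebraMap_toAlgebra]; exact hχ v
  have hcomp : (algebraMap (chartRing g j) (S₁.presheaf.stalk s₁)).comp (chartBase g j) =
      (φ.stalkMap s₁).hom := RingHom.ext halg
  obtain ⟨a, jJ, hjJ, hJ, hJ', ha⟩ := exists_enum_chartGen_mem g j 𝔴.asIdeal
  have hζ := isRsopPart_chartFamily_marked g j f y hz hd 𝔴.asIdeal h𝔴 (S₁.presheaf.stalk s₁)
    jJ hjJ hJ
  have hradZ := radical_map_span_prod_marked_mul_prod_centre g j f y hz hd 𝔴.asIdeal h𝔴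
    (S₁.presheaf.stalk s₁) jJ hjJ hJ hJ' (Nat.succ_pos m)
  have hcons := isRsopPart_cons_centre_marked g j f y hz hd 𝔴.asIdeal h𝔴 (S₁.presheaf.stalk s₁)
  have hradFC := radical_map_span_prod_marked_inf_radical_map_span_centre g j f y hz hd 𝔴.asIdeal
    h𝔴 (S₁.presheaf.stalk s₁)
  rw [hcomp] at hradZ hradFC
  simp only [halg] at hcons hradFC
  refine ⟨k, a, f, g, j, _, hfg.append_left, hIF, ?_, by omega, hζ, ?_, hcons, ?_⟩
  · -- the exceptional ideal `I(C) 𝒪_{S₁,s₁} = (φ^* g_j)`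
    rw [stalkIdeal_comap_eq_map_stalkMap, hIC, ← hcomp, ← Ideal.map_map]
    have h1 : (Ideal.span (Set.range g)).map (chartBase g j) = Ideal.span {chartBase g j (g j)} := by
      have := span_image_reesChartBase_eq (g j) (Ideal.mem_span_range_self (f := g) (x := j))
      rwa [← Ideal.map_span, Ideal.span_eq] at this
    rw [h1, Ideal.map_span, Set.image_singleton, RingHom.comp_apply]
  · -- the ideal of `φ⁻¹ Z`
    rw [stalkIdeal_vanishingIdeal_closure_preimage φ hZc, hIZ, hradZ]
  · -- the ideal of `φ⁻¹ (F ∪ C)`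
    rw [stalkIdeal_vanishingIdeal_closure_preimage φ (hFc.union hC), hclFC,
      stalkIdeal_vanishingIdeal_union hFc hC, ← hclF, hIF, hIC, Ideal.radical_map_inf, hradFC]

end OnCentre

/-! ## The discharge -/

/-- **Discharge of `SNCBlowupTopStratum`** (the chart computation behind de Jong 1996, 2.4):
for a strict normal crossings pair `F ⊆ Z` on a locally Noetherian scheme with
`branchOrder Z ≤ branchOrder F + (m + 1)` and any blowing up `φ` of the reduced top stratum
`C`, (i) `φ⁻¹Z` is a strict normal crossings divisor, (ii) its points lie on at most `m`
branches that are not branches of `φ⁻¹(F ∪ C)`, (iii) at the points of `φ⁻¹(F ∪ C)` its ideal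
is generated by the product of the explicit part `(g, φ^* x)` of a regular system of
parameters. Over the centre this is `exists_chart_data_of_mem_topStratum` (with
`IsRsopPart.cons_of_associated` to pass to arbitrary `g`, `x`); off the centre `φ` is a local
isomorphism (`IsBlowup.isIso_morphismRestrict`) and everything is transported.
[cite: DeJong1996, 2.4, p. 55] -/
theorem SNCBlowupTopStratum_holds : SNCBlowupTopStratum.{u} := by
  intro S _ Z F m hZ hF hFZ hb hC S₁ φ hφ
  classical
  haveI : IsLocallyNoetherian S₁ := isLocallyNoetherian_of_isBlowup hφ
  have hZc : IsClosed Z := hZ.isClosed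
  have hFc : IsClosed F := hF.isClosed
  have hCZ : topStratum S Z F m ⊆ Z := topStratum_subset m
  have hIC : ((vanishingIdeal ⟨topStratum S Z F m, hC⟩).support : Set S) = topStratum S Z F m :=
    coe_support_vanishingIdeal _
  have hZ₁c : IsClosed (φ ⁻¹' Z) := hZc.preimage φ.continuous
  have hclF : (⟨closure F, isClosed_closure⟩ : Closeds S) = ⟨F, hFc⟩ := Closeds.ext hFc.closure_eq
  have hclFC : (⟨closure (F ∪ topStratum S Z F m), isClosed_closure⟩ : Closeds S) =
      ⟨F ∪ topStratum S Z F m, hFc.union hC⟩ := Closeds.ext (hFc.union hC).closure_eq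
  -- off the centre: the ideal of `F ∪ C` at `s ∉ C` is the ideal of `F`
  have hFCs : ∀ s ∉ topStratum S Z F m,
      stalkIdeal (vanishingIdeal ⟨closure (F ∪ topStratum S Z F m), isClosed_closure⟩) s =
        stalkIdeal (vanishingIdeal ⟨closure F, isClosed_closure⟩) s := by
    intro s hs
    rw [hclFC, stalkIdeal_vanishingIdeal_union hFc hC,
      stalkIdeal_eq_top_of_not_mem_support (I := vanishingIdeal ⟨_, hC⟩)
        (by rwa [← SetLike.mem_coe, hIC]), inf_top_eq, hclF]
  refine ⟨?_, ?_, ?_⟩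
  · -- (i) `φ⁻¹ Z` is a strict normal crossings divisor
    refine IsStrictNormalCrossingsDivisor.of_forall_isStrictNormalCrossingsAt hZ₁c fun s₁ hs₁ => ?_
    by_cases hsC : φ s₁ ∈ topStratum S Z F m
    · obtain ⟨k, a, f, g, j, ζ, -, -, -, -, hζ, hIZ₁, -, -⟩ :=
        exists_chart_data_of_mem_topStratum hZ hF hFZ hb hC hφ s₁ hsC
      change IsSNCIdeal _
      rw [isSNCIdeal_iff_exists_isRsopPart]
      exact ⟨a + k + 1, ζ, by omega, hζ, hIZ₁⟩
    · exact hφ.isStrictNormalCrossingsAt_preimage_of_not_mem hC hIC hZc hsC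
        (hZ.isStrictNormalCrossingsAt hs₁)
  · -- (ii) the bound `m`
    intro s₁ hs₁
    by_cases hsC : φ s₁ ∈ topStratum S Z F m
    · obtain ⟨k, a, f, g, j, ζ, -, -, -, ha, hζ, hIZ₁, hcons, hIFC₁⟩ :=
        exists_chart_data_of_mem_topStratum hZ hF hFZ hb hC hφ s₁ hsC
      have hprod : (φ.stalkMap s₁).hom (g j) * ∏ s, (φ.stalkMap s₁).hom (f s) =
          ∏ i, (Fin.cons ((φ.stalkMap s₁).hom (g j)) ((φ.stalkMap s₁).hom ∘ f) :
            Fin (k + 1) → _) i := by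
        rw [Fin.prod_univ_succ]
        simp
      rw [hprod] at hIFC₁
      rw [branchOrder_eq_of_isRsopPart hζ hIZ₁, branchOrder_eq_of_isRsopPart hcons hIFC₁]
      exact_mod_cast (by omega : a + k + 1 ≤ k + 1 + m)
    · rw [hφ.branchOrder_preimage_of_not_mem hC hIC hZc hsC,
        hφ.branchOrder_preimage_of_not_mem hC hIC (hFc.union hC) hsC,
        branchOrder_congr_stalkIdeal (hFCs _ hsC)]
      obtain ⟨k, n, f, g, -, hfg, hIZ, hIF⟩ := exists_matched_rsop hFZ hFc
        (hZ.isStrictNormalCrossingsAt hs₁) fun h => hF.isStrictNormalCrossingsAt h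
      obtain ⟨hbZ, hbF⟩ := branchOrder_eq_of_matched hfg hIZ hIF
      have hle := hb _ hs₁
      rw [mem_topStratum_iff, hbZ, hbF] at hsC
      rw [hbZ, hbF] at hle ⊢
      have hle' : k + n ≤ k + (m + 1) := by exact_mod_cast hle
      have hne : k + n ≠ k + (m + 1) := fun h => hsC ⟨hs₁, by exact_mod_cast h⟩
      exact_mod_cast (by omega : k + n ≤ k + m)
  · -- (iii) the explicit regular parameters at the points of `φ⁻¹ (F ∪ C)`
    intro s₁ hs₁ g₀ hg₀ n x hx hIx
    by_cases hsC : φ s₁ ∈ topStratum S Z F m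
    · obtain ⟨k, a, f, g, j, ζ, hf, hIF, hexc, -, -, -, hcons, hIFC₁⟩ :=
        exists_chart_data_of_mem_topStratum hZ hF hFZ hb hC hφ s₁ hsC
      haveI := hcons.isRegularLocalRing
      haveI := isDomain_of_isRegularLocalRing (S₁.presheaf.stalk s₁)
      have hg : Associated g₀ ((φ.stalkMap s₁).hom (g j)) := by
        rw [← Ideal.span_singleton_eq_span_singleton, ← hg₀, hexc]
      have hnu : ¬ IsUnit g₀ := by
        intro hu
        have hmem : (φ.stalkMap s₁).hom (g j) ∈ maximalIdeal (S₁.presheaf.stalk s₁) := by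
          simpa using hcons.mem_maximalIdeal 0
        obtain ⟨u, hu'⟩ := hg
        rw [← hu'] at hmem
        exact (IsLocalRing.mem_maximalIdeal _).mp hmem (hu.mul u.isUnit)
      refine ⟨fun hu => absurd hu hnu, fun _ => ?_⟩
      obtain ⟨σ, hσ⟩ := hx.exists_equiv_associated hf (hIx.symm.trans hIF)
      obtain ⟨hr, hI⟩ := hcons.cons_of_associated hg σ (x' := (φ.stalkMap s₁).hom ∘ x)
        fun t => (hσ t).map (φ.stalkMap s₁).hom
      exact ⟨hr, hIFC₁.trans hI.symm⟩
    · -- off the centre `g₀` is a unit and `φ` is a local isomorphism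
      have htop : stalkIdeal ((vanishingIdeal ⟨topStratum S Z F m, hC⟩).comap φ) s₁ = ⊤ := by
        rw [stalkIdeal_comap_eq_map_stalkMap,
          stalkIdeal_eq_top_of_not_mem_support (by rwa [← SetLike.mem_coe, hIC]), Ideal.map_top]
      have hu : IsUnit g₀ := by
        rw [← Ideal.span_singleton_eq_top, ← hg₀, htop]
      refine ⟨fun _ => ?_, fun hnu => absurd hu hnu⟩
      haveI := hφ.isIso_stalkMap_of_not_mem hC hIC hsC
      let ε : S.presheaf.stalk (φ s₁) ≃+* S₁.presheaf.stalk s₁ :=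
        (asIso (φ.stalkMap s₁)).commRingCatIsoToRingEquiv
      have hε : (ε : S.presheaf.stalk (φ s₁) → S₁.presheaf.stalk s₁) = (φ.stalkMap s₁).hom := rfl
      have hx₁ : IsRsopPart ((φ.stalkMap s₁).hom ∘ x) := by
        rw [← hε]
        exact hx.map_ringEquiv ε
      refine ⟨hx₁, ?_⟩
      rw [stalkIdeal_vanishingIdeal_closure_preimage φ (hFc.union hC), hFCs _ hsC, hIx,
        Ideal.map_span, Set.image_singleton, map_prod]
      exact hx₁.isRadical_span_prod.radical

/-- **de Jong 1996, 2.4, the blowing-up step** — DISCHARGE of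
`DeJong1996NormalCrossingsBlowupStep` (`NormalCrossingsStrictification.lean`), from
`SNCBlowupTopStratum_holds` by étale descent
(`DeJong1996NormalCrossingsBlowupStep.of_sncBlowupTopStratum`). [cite: DeJong1996, 2.4, p. 55] -/
theorem DeJong1996NormalCrossingsBlowupStep_holds : DeJong1996NormalCrossingsBlowupStep.{u} :=
  DeJong1996NormalCrossingsBlowupStep.of_sncBlowupTopStratum SNCBlowupTopStratum_holds

end Literature.AlgebraicGeometry.Resolution

end
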